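import Literature.NumberTheory.Automorphic.ArchUnitaryRootSubgroups            -- ★ A2 p844430 (this seat): block boosts ∕ rotations, jets at `0`
import Literature.NumberTheory.Automorphic.ArchConjugationCurveIntegralDeriv      -- ★ Z2 p843797: `s`-derivatives of `∫ f(h c(s) h⁻¹) dμ` under the integral sign
import Literature.NumberTheory.Automorphic.ArchLocalTorusOrbitalContinuity        -- ★ `isCompact_setOf_exists_conj_circleDiagonal_mem`
import Literature.NumberTheory.Automorphic.ArchTorusOrbitalFubiniSmooth           -- ★ `isCompact_setOf_coe_archLocal_mem`
import Literature.NumberTheory.Automorphic.ArchLocalTorusOrbitalDeriv             -- ★ `coe_conj_archLocal`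
import Mathlib.MeasureTheory.Group.Integral
import HarnessLib

/-!
# Right-invariance kills the jets of a one-parameter subgroup: `∫ [D²f(hγh⁻¹)(h c′(0) h⁻¹)² + Df(hγh⁻¹)(h c″(0) h⁻¹)] dμ(h) = 0` on any `U(diag e) ≤ GL_N(ℂ)`
# (Varadarajan 1989 §6.3) — ★ Z3a `ArchRankOneCasimirBoostJets` §1–§3 for a root block of any `GL_N`

Topic `NumberTheory/Automorphic`; namespace `Literature.NumberTheory.Automorphic.RootVectors`.  THEOREMS ONLY (no `def`, no instance, no notation, no axiom, no named fact,
no `sorry`).  Cell `pub/hodgecm-mathlib`, ENGINE T1 (crux H413 = `stmt-HodgeConjecture-24833`); ROAD A owner word 2026-09-01T12:22:33Z (o2′) «RANK-2 CASIMIR RADIAL EQUATION»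
(census bac477e2), FILE C.  Author A-p18 (g26), 2026-09-01.

WHAT IS PROVED.
* §1 (any subgroup `S ≤ GL_N(ℂ)`, `μ` finite on compacta and right-invariant, `f ∈ C²_c(M_N(ℂ); E)`): if `U : ℝ → S` is continuous, `c, c₁, c₂ : ℝ → M_N(ℂ)` with `c′ = c₁`,
  `c₁′ = c₂`, `c₂` continuous, `c(0) = γ`, `(hU(s))γ(hU(s))⁻¹ = h c(s) h⁻¹`, and `{g ∈ S | gγg⁻¹ ∈ supp f}` is compact, then
  `h ↦ D²f(hγh⁻¹)(hc₁(0)h⁻¹, hc₁(0)h⁻¹) + Df(hγh⁻¹)(hc₂(0)h⁻¹)` is integrable with integral `0` (`integral_curveJets_eq_zero`): `A(s) = ∫ f(h c(s) h⁻¹) dμ` is constant by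
  right-invariance, and ★ Z2 computes `A′`, `A″(0)`.
* §2 (`S = G_w = U(diag a)_w`, `a_i ≠ 0`): the block boost `u(s) = 1 + (ch s − 1)P + sh s·X` (`P² = P`, `PX = XP = X`, `X² = P`, `Pᴴ = P`, `PH = HP`, `XᴴH = −HX`,
  `H = diag(w(a))`) is a continuous one-parameter family in `G_w` (`exists_blockBoost`); the same for the block rotation (`X² = −P`, `cos ∕ sin`; `exists_blockRot`);
  the carrier `{g | g·diag ζ·g⁻¹ ∈ C}` is compact for `ζ` regular (`isCompact_setOf_conj_diagonal_mem`).
* §3 THE JET IDENTITIES at a regular torus point `γ = diag ζ`: `∫ [D²f(hγh⁻¹)(h(Xγ − γX)h⁻¹)² + Df(hγh⁻¹)(h((Pγ + γP) − 2XγX)h⁻¹)] dμ = 0` for a block boost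
  (`integral_blockBoostJet_eq_zero`) and with `−(Pγ + γP) − 2XγX` for a block rotation (`integral_blockRotJet_eq_zero`).
HONEST LABEL: bookkeeping over ★ Z2 and ★ A2; pays nothing by itself (HC_CM is proved only modulo the printed citations until rung 0 closes).

## References
* [Varadarajan1989] V. S. Varadarajan, *An Introduction to Harmonic Analysis on Semisimple Lie Groups* (1989), §6.3.
* [Folland1995] G. B. Folland, *A Course in Abstract Harmonic Analysis* (1995), §2.6.
* [Rogawski1990] J. D. Rogawski, *Automorphic Representations of Unitary Groups in Three Variables* (1990), §8.3.
-/

set_option autoImplicit false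

namespace Literature.NumberTheory.Automorphic.RootVectors

open _root_.Complex _root_.Matrix _root_.MeasureTheory _root_.Set _root_.Filter _root_.Topology _root_.NumberField _root_.NumberField.InfinitePlace
open _root_.Literature.NumberTheory.Automorphic.UnitaryGroup _root_.Literature.NumberTheory.Automorphic.ConjugationCurve
open scoped Matrix.Norms.Operator MatrixGroups ComplexConjugate

variable {N : ℕ}

/-! ## §1 Right-invariance kills the jets of a one-parameter family -/

section Abstract

variable {E : Type*} [NormedAddCommGroup E] [NormedSpace ℝ E] [CompleteSpace E]

/-- **Right-invariance kills the jets of a one-parameter family.**  `S ≤ GL_N(ℂ)`, `μ` finite on compacta and right-invariant, `f ∈ C²` ; `U : ℝ → S` continuous, `c′ = c₁`,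
`c₁′ = c₂` continuous, `c(0) = γ`, `(hU(s))γ(hU(s))⁻¹ = h c(s) h⁻¹`, and the carrier `{g | gγg⁻¹ ∈ supp f}` compact.  Then `∫ [D²f(hγh⁻¹)(hc₁(0)h⁻¹)² + Df(hγh⁻¹)(hc₂(0)h⁻¹)] dμ = 0`
(and the integrand is integrable): `A(s) = ∫ f(h c(s) h⁻¹) dμ(h) = A(0)` by right-invariance, while ★ Z2 gives `A′(s) = ∫ Df(h c(s) h⁻¹)(h c₁(s) h⁻¹)` near `0` and the
derivative of the latter at `0`. [cite: Varadarajan1989, §6.3] [cite: Folland1995, §2.6] -/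
theorem integral_curveJets_eq_zero (S : Subgroup (GL (Fin N) ℂ)) [MeasurableSpace S] [BorelSpace S] (μ : Measure S) [IsFiniteMeasureOnCompacts μ] [μ.IsMulRightInvariant]
    (f : Matrix (Fin N) (Fin N) ℂ → E) (hf : ContDiff ℝ 2 f) {U : ℝ → S} (hUc : Continuous U) {c c₁ c₂ : ℝ → Matrix (Fin N) (Fin N) ℂ} (hcd : ∀ s, HasDerivAt c (c₁ s) s)
    (hc₁d : ∀ s, HasDerivAt c₁ (c₂ s) s) (hc₂c : Continuous c₂) {γ : Matrix (Fin N) (Fin N) ℂ} (e0 : c 0 = γ)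
    (hconjU : ∀ (h : S) (s : ℝ), (((h * U s : S) : GL (Fin N) ℂ) : Matrix (Fin N) (Fin N) ℂ) * γ * ((((h * U s)⁻¹ : S) : GL (Fin N) ℂ) : Matrix (Fin N) (Fin N) ℂ) = ((h : GL (Fin N) ℂ) : Matrix (Fin N) (Fin N) ℂ) * c s * (((h⁻¹ : S) : GL (Fin N) ℂ) : Matrix (Fin N) (Fin N) ℂ))
    (hK₀ : IsCompact {g : S | ((g : GL (Fin N) ℂ) : Matrix (Fin N) (Fin N) ℂ) * γ * (((g⁻¹ : S) : GL (Fin N) ℂ) : Matrix (Fin N) (Fin N) ℂ) ∈ tsupport f}) :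
    Integrable (fun h : S =>
        fderiv ℝ (fderiv ℝ f) (((h : GL (Fin N) ℂ) : Matrix (Fin N) (Fin N) ℂ) * γ * (((h⁻¹ : S) : GL (Fin N) ℂ) : Matrix (Fin N) (Fin N) ℂ)) (((h : GL (Fin N) ℂ) : Matrix (Fin N) (Fin N) ℂ) * c₁ 0 * (((h⁻¹ : S) : GL (Fin N) ℂ) : Matrix (Fin N) (Fin N) ℂ)) (((h : GL (Fin N) ℂ) : Matrix (Fin N) (Fin N) ℂ) * c₁ 0 * (((h⁻¹ : S) : GL (Fin N) ℂ) : Matrix (Fin N) (Fin N) ℂ)) +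
          fderiv ℝ f (((h : GL (Fin N) ℂ) : Matrix (Fin N) (Fin N) ℂ) * γ * (((h⁻¹ : S) : GL (Fin N) ℂ) : Matrix (Fin N) (Fin N) ℂ)) (((h : GL (Fin N) ℂ) : Matrix (Fin N) (Fin N) ℂ) * c₂ 0 * (((h⁻¹ : S) : GL (Fin N) ℂ) : Matrix (Fin N) (Fin N) ℂ))) μ ∧
      ∫ h : S, (fderiv ℝ (fderiv ℝ f) (((h : GL (Fin N) ℂ) : Matrix (Fin N) (Fin N) ℂ) * γ * (((h⁻¹ : S) : GL (Fin N) ℂ) : Matrix (Fin N) (Fin N) ℂ)) (((h : GL (Fin N) ℂ) : Matrix (Fin N) (Fin N) ℂ) * c₁ 0 * (((h⁻¹ : S) : GL (Fin N) ℂ) : Matrix (Fin N) (Fin N) ℂ)) (((h : GL (Fin N) ℂ) : Matrix (Fin N) (Fin N) ℂ) * c₁ 0 * (((h⁻¹ : S) : GL (Fin N) ℂ) : Matrix (Fin N) (Fin N) ℂ)) +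
          fderiv ℝ f (((h : GL (Fin N) ℂ) : Matrix (Fin N) (Fin N) ℂ) * γ * (((h⁻¹ : S) : GL (Fin N) ℂ) : Matrix (Fin N) (Fin N) ℂ)) (((h : GL (Fin N) ℂ) : Matrix (Fin N) (Fin N) ℂ) * c₂ 0 * (((h⁻¹ : S) : GL (Fin N) ℂ) : Matrix (Fin N) (Fin N) ℂ))) ∂μ = 0 := by
  have hc₁c : Continuous c₁ := continuous_iff_continuousAt.2 fun s => (hc₁d s).continuousAt
  -- the compact carrier `K = K₀ · U([−1,1])⁻¹`
  have hK : IsCompact ((fun p : S × ℝ => p.1 * (U p.2)⁻¹) '' ({g : S | ((g : GL (Fin N) ℂ) : Matrix (Fin N) (Fin N) ℂ) * γ * (((g⁻¹ : S) : GL (Fin N) ℂ) : Matrix (Fin N) (Fin N) ℂ) ∈ tsupport f} ×ˢ Metric.closedBall (0 : ℝ) 1)) :=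
    (hK₀.prod (isCompact_closedBall (0 : ℝ) 1)).image (continuous_fst.mul (hUc.comp continuous_snd).inv)
  have hcar : ∀ s ∈ Metric.ball (0 : ℝ) 1, ∀ h : S, h ∉ (fun p : S × ℝ => p.1 * (U p.2)⁻¹) '' ({g : S | ((g : GL (Fin N) ℂ) : Matrix (Fin N) (Fin N) ℂ) * γ * (((g⁻¹ : S) : GL (Fin N) ℂ) : Matrix (Fin N) (Fin N) ℂ) ∈ tsupport f} ×ˢ Metric.closedBall (0 : ℝ) 1) →
      ((h : GL (Fin N) ℂ) : Matrix (Fin N) (Fin N) ℂ) * c s * (((h⁻¹ : S) : GL (Fin N) ℂ) : Matrix (Fin N) (Fin N) ℂ) ∉ tsupport f := by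
    intro s hs h hh hmem
    refine hh ⟨(h * U s, s), ⟨?_, Metric.ball_subset_closedBall hs⟩, mul_inv_cancel_right h (U s)⟩
    show (((h * U s : S) : GL (Fin N) ℂ) : Matrix (Fin N) (Fin N) ℂ) * γ * ((((h * U s)⁻¹ : S) : GL (Fin N) ℂ) : Matrix (Fin N) (Fin N) ℂ) ∈ tsupport f
    rw [hconjU]; exact hmem
  have hball : ∀ s₀ ∈ Metric.ball (0 : ℝ) (1 / 2), ∀ s ∈ Metric.ball s₀ (1 / 2), s ∈ Metric.ball (0 : ℝ) 1 := fun s₀ hs₀ s hs => by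
    rw [Metric.mem_ball, Real.dist_eq] at hs₀ hs ⊢
    rw [sub_zero] at hs₀ ⊢
    calc |s| = |s - s₀ + s₀| := by rw [sub_add_cancel]
      _ ≤ |s - s₀| + |s₀| := abs_add_le _ _
      _ < 1 := by linarith
  -- `A(s) = A(0)`: right-invariance
  have hA : ∀ s, ∫ h : S, f (((h : GL (Fin N) ℂ) : Matrix (Fin N) (Fin N) ℂ) * c s * (((h⁻¹ : S) : GL (Fin N) ℂ) : Matrix (Fin N) (Fin N) ℂ)) ∂μ = ∫ h : S, f (((h : GL (Fin N) ℂ) : Matrix (Fin N) (Fin N) ℂ) * γ * (((h⁻¹ : S) : GL (Fin N) ℂ) : Matrix (Fin N) (Fin N) ℂ)) ∂μ := fun s => by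
    rw [← integral_mul_right_eq_self (fun g : S => f (((g : GL (Fin N) ℂ) : Matrix (Fin N) (Fin N) ℂ) * γ * (((g⁻¹ : S) : GL (Fin N) ℂ) : Matrix (Fin N) (Fin N) ℂ))) (U s)]
    refine integral_congr_ae (Eventually.of_forall fun h => ?_)
    show f (((h : GL (Fin N) ℂ) : Matrix (Fin N) (Fin N) ℂ) * c s * (((h⁻¹ : S) : GL (Fin N) ℂ) : Matrix (Fin N) (Fin N) ℂ)) = f ((((h * U s : S) : GL (Fin N) ℂ) : Matrix (Fin N) (Fin N) ℂ) * γ * ((((h * U s)⁻¹ : S) : GL (Fin N) ℂ) : Matrix (Fin N) (Fin N) ℂ))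
    rw [hconjU]
  -- `A′ = 0` on `|s₀| < 1∕2` (★ Z2 (a) vs. the constant)
  have hA' : ∀ s₀ ∈ Metric.ball (0 : ℝ) (1 / 2), ∫ h : S, fderiv ℝ f (((h : GL (Fin N) ℂ) : Matrix (Fin N) (Fin N) ℂ) * c s₀ * (((h⁻¹ : S) : GL (Fin N) ℂ) : Matrix (Fin N) (Fin N) ℂ)) (((h : GL (Fin N) ℂ) : Matrix (Fin N) (Fin N) ℂ) * c₁ s₀ * (((h⁻¹ : S) : GL (Fin N) ℂ) : Matrix (Fin N) (Fin N) ℂ)) ∂μ = 0 := fun s₀ hs₀ => by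
    have h1 := (hasDerivAt_integral_comp_conj_curve S μ f (hf.of_le (by norm_num)) hcd hc₁c (by norm_num : (0 : ℝ) < 1 / 2) hK
      (fun s hs h hh => hcar s (hball s₀ hs₀ s hs) h hh)).2
    have h2 : HasDerivAt (fun s => ∫ h : S, f (((h : GL (Fin N) ℂ) : Matrix (Fin N) (Fin N) ℂ) * c s * (((h⁻¹ : S) : GL (Fin N) ℂ) : Matrix (Fin N) (Fin N) ℂ)) ∂μ) 0 s₀ := by
      have hconst : (fun s => ∫ h : S, f (((h : GL (Fin N) ℂ) : Matrix (Fin N) (Fin N) ℂ) * c s * (((h⁻¹ : S) : GL (Fin N) ℂ) : Matrix (Fin N) (Fin N) ℂ)) ∂μ) = fun _ => ∫ h : S, f (((h : GL (Fin N) ℂ) : Matrix (Fin N) (Fin N) ℂ) * γ * (((h⁻¹ : S) : GL (Fin N) ℂ) : Matrix (Fin N) (Fin N) ℂ)) ∂μ := funext hA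
      rw [hconst]; exact hasDerivAt_const s₀ _
    exact h1.unique h2
  -- `A″(0) = 0` (★ Z2 (b) vs. `A′ ≡ 0` near `0`)
  have h3 := hasDerivAt_integral_fderiv_comp_conj_curve S μ f hf hcd hc₁d hc₂c (by norm_num : (0 : ℝ) < 1 / 2) hK
    (fun s hs h hh => hcar s (hball 0 (Metric.mem_ball_self (by norm_num)) s hs) h hh)
  have h4 : HasDerivAt (fun s => ∫ h : S, fderiv ℝ f (((h : GL (Fin N) ℂ) : Matrix (Fin N) (Fin N) ℂ) * c s * (((h⁻¹ : S) : GL (Fin N) ℂ) : Matrix (Fin N) (Fin N) ℂ)) (((h : GL (Fin N) ℂ) : Matrix (Fin N) (Fin N) ℂ) * c₁ s * (((h⁻¹ : S) : GL (Fin N) ℂ) : Matrix (Fin N) (Fin N) ℂ)) ∂μ) 0 0 := by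
    refine (hasDerivAt_const (0 : ℝ) (0 : E)).congr_of_eventuallyEq ?_
    filter_upwards [Metric.ball_mem_nhds (0 : ℝ) (by norm_num : (0 : ℝ) < 1 / 2)] with s hs
    exact hA' s hs
  have h5 := h3.2.unique h4
  rw [e0] at h3 h5
  exact ⟨h3.1, h5⟩

end Abstract

/-! ## §2 Block boosts and rotations inside `G_w = U(diag a)_w`, and the compact carrier at a regular torus point -/

section ArchLocal

variable (L : Type) [Field L] (a : Fin N → L) (w : {w : InfinitePlace L // IsComplex w})

/-- **The block boost is a continuous one-parameter family in `G_w`**, with values `u(s) = 1 + (ch s − 1)P + sh s·X` and `u(s)⁻¹ = u(−s)`. [cite: Varadarajan1989, §6.3] -/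
theorem exists_blockBoost (X P : Matrix (Fin N) (Fin N) ℂ) (hPP : P * P = P) (hPX : P * X = X) (hXP : X * P = X) (hXX : X * X = P) (hPs : star P = P)
    (hPH : P * (Matrix.diagonal a).map w.1.embedding = (Matrix.diagonal a).map w.1.embedding * P) (hXH : star X * (Matrix.diagonal a).map w.1.embedding = -((Matrix.diagonal a).map w.1.embedding * X)) :
    ∃ U : ℝ → archLocal L N (Matrix.diagonal a) w, Continuous U ∧ ∀ s : ℝ,
      ((U s : GL (Fin N) ℂ) : Matrix (Fin N) (Fin N) ℂ) = ((1 : Matrix (Fin N) (Fin N) ℂ) + (cosh (s : ℂ) - 1) • P + sinh (s : ℂ) • X) ∧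
      ((((U s)⁻¹ : archLocal L N (Matrix.diagonal a) w) : GL (Fin N) ℂ) : Matrix (Fin N) (Fin N) ℂ) = ((1 : Matrix (Fin N) (Fin N) ℂ) + (cosh (s : ℂ) - 1) • P - sinh (s : ℂ) • X) := by
  have hch : Continuous fun s : ℝ => cosh (s : ℂ) := Complex.continuous_cosh.comp Complex.continuous_ofReal
  have hsh : Continuous fun s : ℝ => sinh (s : ℂ) := Complex.continuous_sinh.comp Complex.continuous_ofReal
  obtain ⟨u, hu⟩ : ∃ u : ℝ → GL (Fin N) ℂ, u = fun s =>
      ⟨((1 : Matrix (Fin N) (Fin N) ℂ) + (cosh (s : ℂ) - 1) • P + sinh (s : ℂ) • X), ((1 : Matrix (Fin N) (Fin N) ℂ) + (cosh (s : ℂ) - 1) • P - sinh (s : ℂ) • X),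
        blockBoost_mul_blockBoost_neg X P hPP hPX hXP hXX s, blockBoost_neg_mul_blockBoost X P hPP hPX hXP hXX s⟩ := ⟨_, rfl⟩
  have hval : ∀ s, ((u s : GL (Fin N) ℂ) : Matrix (Fin N) (Fin N) ℂ) = ((1 : Matrix (Fin N) (Fin N) ℂ) + (cosh (s : ℂ) - 1) • P + sinh (s : ℂ) • X) := fun s => by
    rw [hu]
  have hinv : ∀ s, (((u s)⁻¹ : GL (Fin N) ℂ) : Matrix (Fin N) (Fin N) ℂ) = ((1 : Matrix (Fin N) (Fin N) ℂ) + (cosh (s : ℂ) - 1) • P - sinh (s : ℂ) • X) := fun s => by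
    rw [hu]; rfl
  have hmem : ∀ s, u s ∈ archLocal L N (Matrix.diagonal a) w := fun s => by
    rw [mem_archLocal_iff_conjTranspose, hval, ← Matrix.star_eq_conjTranspose]
    exact star_blockBoost_mul_mul_blockBoost X P hPP hPX hXP hXX _ hXH hPs hPH s
  have hcont : Continuous u := by
    refine Units.continuous_iff.2 ⟨?_, ?_⟩
    · show Continuous fun s => ((u s : GL (Fin N) ℂ) : Matrix (Fin N) (Fin N) ℂ)
      simp_rw [hval]; exact (continuous_const.add ((hch.sub continuous_const).smul continuous_const)).add (hsh.smul continuous_const)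
    · simp_rw [hinv]; exact (continuous_const.add ((hch.sub continuous_const).smul continuous_const)).sub (hsh.smul continuous_const)
  refine ⟨fun s => ⟨u s, hmem s⟩, hcont.subtype_mk _, fun s => ⟨hval s, ?_⟩⟩
  rw [← hinv s]
  rfl

/-- **The block rotation is a continuous one-parameter family in `G_w`**, with values `u(s) = 1 + (cos s − 1)P + sin s·X` and `u(s)⁻¹ = u(−s)`. [cite: Varadarajan1989, §6.3] -/
theorem exists_blockRot (X P : Matrix (Fin N) (Fin N) ℂ) (hPP : P * P = P) (hPX : P * X = X) (hXP : X * P = X) (hXX : X * X = -P) (hPs : star P = P)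
    (hPH : P * (Matrix.diagonal a).map w.1.embedding = (Matrix.diagonal a).map w.1.embedding * P) (hXH : star X * (Matrix.diagonal a).map w.1.embedding = -((Matrix.diagonal a).map w.1.embedding * X)) :
    ∃ U : ℝ → archLocal L N (Matrix.diagonal a) w, Continuous U ∧ ∀ s : ℝ,
      ((U s : GL (Fin N) ℂ) : Matrix (Fin N) (Fin N) ℂ) = ((1 : Matrix (Fin N) (Fin N) ℂ) + (Complex.cos (s : ℂ) - 1) • P + Complex.sin (s : ℂ) • X) ∧
      ((((U s)⁻¹ : archLocal L N (Matrix.diagonal a) w) : GL (Fin N) ℂ) : Matrix (Fin N) (Fin N) ℂ) = ((1 : Matrix (Fin N) (Fin N) ℂ) + (Complex.cos (s : ℂ) - 1) • P - Complex.sin (s : ℂ) • X) := by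
  have hch : Continuous fun s : ℝ => Complex.cos (s : ℂ) := Complex.continuous_cos.comp Complex.continuous_ofReal
  have hsh : Continuous fun s : ℝ => Complex.sin (s : ℂ) := Complex.continuous_sin.comp Complex.continuous_ofReal
  obtain ⟨u, hu⟩ : ∃ u : ℝ → GL (Fin N) ℂ, u = fun s =>
      ⟨((1 : Matrix (Fin N) (Fin N) ℂ) + (Complex.cos (s : ℂ) - 1) • P + Complex.sin (s : ℂ) • X), ((1 : Matrix (Fin N) (Fin N) ℂ) + (Complex.cos (s : ℂ) - 1) • P - Complex.sin (s : ℂ) • X),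
        blockRot_mul_blockRot_neg X P hPP hPX hXP hXX s, blockRot_neg_mul_blockRot X P hPP hPX hXP hXX s⟩ := ⟨_, rfl⟩
  have hval : ∀ s, ((u s : GL (Fin N) ℂ) : Matrix (Fin N) (Fin N) ℂ) = ((1 : Matrix (Fin N) (Fin N) ℂ) + (Complex.cos (s : ℂ) - 1) • P + Complex.sin (s : ℂ) • X) := fun s => by
    rw [hu]
  have hinv : ∀ s, (((u s)⁻¹ : GL (Fin N) ℂ) : Matrix (Fin N) (Fin N) ℂ) = ((1 : Matrix (Fin N) (Fin N) ℂ) + (Complex.cos (s : ℂ) - 1) • P - Complex.sin (s : ℂ) • X) := fun s => by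
    rw [hu]; rfl
  have hmem : ∀ s, u s ∈ archLocal L N (Matrix.diagonal a) w := fun s => by
    rw [mem_archLocal_iff_conjTranspose, hval, ← Matrix.star_eq_conjTranspose]
    exact star_blockRot_mul_mul_blockRot X P hPP hPX hXP hXX _ hXH hPs hPH s
  have hcont : Continuous u := by
    refine Units.continuous_iff.2 ⟨?_, ?_⟩
    · show Continuous fun s => ((u s : GL (Fin N) ℂ) : Matrix (Fin N) (Fin N) ℂ)
      simp_rw [hval]; exact (continuous_const.add ((hch.sub continuous_const).smul continuous_const)).add (hsh.smul continuous_const)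
    · simp_rw [hinv]; exact (continuous_const.add ((hch.sub continuous_const).smul continuous_const)).sub (hsh.smul continuous_const)
  refine ⟨fun s => ⟨u s, hmem s⟩, hcont.subtype_mk _, fun s => ⟨hval s, ?_⟩⟩
  rw [← hinv s]
  rfl

/-- **Compact carrier at a regular torus point** (any `N`): for `a_i ≠ 0`, `C ⊆ M_N(ℂ)` compact and `ζ ∈ (S¹)^N` injective, `{h ∈ G_w | h·diag ζ·h⁻¹ ∈ C}` is compact
(★ `isCompact_setOf_exists_conj_circleDiagonal_mem` with `K = {ζ}` over ★ `isCompact_setOf_coe_archLocal_mem`). [cite: Rogawski1990, §8.3 p. 122] -/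
theorem isCompact_setOf_conj_diagonal_mem (ha : ∀ i, a i ≠ 0) {C : Set (Matrix (Fin N) (Fin N) ℂ)} (hC : IsCompact C)
    {ζ : Fin N → Circle} (hζ : Function.Injective ζ) :
    IsCompact {g : archLocal L N (Matrix.diagonal a) w | ((g : GL (Fin N) ℂ) : Matrix (Fin N) (Fin N) ℂ) * (Matrix.diagonal fun i => (ζ i : ℂ)) * (((g⁻¹ : archLocal L N (Matrix.diagonal a) w) : GL (Fin N) ℂ) : Matrix (Fin N) (Fin N) ℂ) ∈ C} := by
  have hC' := isCompact_setOf_coe_archLocal_mem L N a w ha hC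
  have h := isCompact_setOf_exists_conj_circleDiagonal_mem L N a w ha (K := {ζ}) isCompact_singleton
    (fun v hv => by rw [Set.mem_singleton_iff.1 hv]; exact hζ) hC'
  have hEq : {g : archLocal L N (Matrix.diagonal a) w | ((g : GL (Fin N) ℂ) : Matrix (Fin N) (Fin N) ℂ) * (Matrix.diagonal fun i => (ζ i : ℂ)) * (((g⁻¹ : archLocal L N (Matrix.diagonal a) w) : GL (Fin N) ℂ) : Matrix (Fin N) (Fin N) ℂ) ∈ C} =
      {g : archLocal L N (Matrix.diagonal a) w | ∃ v ∈ ({ζ} : Set (Fin N → Circle)),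
        g * ⟨circleDiagonal N v, circleDiagonal_mem_archLocal_diagonal L N a w v⟩ * g⁻¹ ∈ {g : archLocal L N (Matrix.diagonal a) w | ((g : GL (Fin N) ℂ) : Matrix (Fin N) (Fin N) ℂ) ∈ C}} := by
    ext g
    simp only [Set.mem_setOf_eq, Set.mem_singleton_iff, exists_eq_left, coe_conj_archLocal, coe_circleDiagonal]
  rw [hEq]
  exact h

end ArchLocal

/-! ## §3 The jet identities for a block boost ∕ rotation at a regular torus point -/

section Jets

variable (L : Type) [Field L] (a : Fin N → L) (w : {w : InfinitePlace L // IsComplex w})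
variable {E : Type*} [NormedAddCommGroup E] [NormedSpace ℝ E] [CompleteSpace E]
variable [MeasurableSpace (archLocal L N (Matrix.diagonal a) w)] [BorelSpace (archLocal L N (Matrix.diagonal a) w)]

/-- **Right-invariance kills the block-boost jets at a regular torus point.**  For `S = G_w`, `μ` finite on compacta and right-invariant, `f ∈ C²_c(M_N(ℂ); E)`, a block
boost `(X, P)` of `𝔲(diag w(a))` and `γ = diag ζ` with `ζ` injective:
`∫ [D²f(hγh⁻¹)(h(Xγ − γX)h⁻¹, h(Xγ − γX)h⁻¹) + Df(hγh⁻¹)(h((Pγ + γP) − 2XγX)h⁻¹)] dμ(h) = 0`, and the integrand is integrable. [cite: Varadarajan1989, §6.3] [cite: Folland1995, §2.6] -/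
theorem integral_blockBoostJet_eq_zero (μ : Measure (archLocal L N (Matrix.diagonal a) w)) [IsFiniteMeasureOnCompacts μ] [μ.IsMulRightInvariant]
    (ha : ∀ i, a i ≠ 0) (f : Matrix (Fin N) (Fin N) ℂ → E) (hf : ContDiff ℝ 2 f) (hfc : HasCompactSupport f)
    (X P : Matrix (Fin N) (Fin N) ℂ) (hPP : P * P = P) (hPX : P * X = X) (hXP : X * P = X) (hXX : X * X = P) (hPs : star P = P)
    (hPH : P * (Matrix.diagonal a).map w.1.embedding = (Matrix.diagonal a).map w.1.embedding * P) (hXH : star X * (Matrix.diagonal a).map w.1.embedding = -((Matrix.diagonal a).map w.1.embedding * X))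
    {ζ : Fin N → Circle} (hζ : Function.Injective ζ) {γ : Matrix (Fin N) (Fin N) ℂ} (hγ : γ = Matrix.diagonal fun i => (ζ i : ℂ)) :
    Integrable (fun h : archLocal L N (Matrix.diagonal a) w =>
        fderiv ℝ (fderiv ℝ f) (((h : GL (Fin N) ℂ) : Matrix (Fin N) (Fin N) ℂ) * γ * (((h⁻¹ : archLocal L N (Matrix.diagonal a) w) : GL (Fin N) ℂ) : Matrix (Fin N) (Fin N) ℂ)) (((h : GL (Fin N) ℂ) : Matrix (Fin N) (Fin N) ℂ) * (X * γ - γ * X) * (((h⁻¹ : archLocal L N (Matrix.diagonal a) w) : GL (Fin N) ℂ) : Matrix (Fin N) (Fin N) ℂ)) (((h : GL (Fin N) ℂ) : Matrix (Fin N) (Fin N) ℂ) * (X * γ - γ * X) * (((h⁻¹ : archLocal L N (Matrix.diagonal a) w) : GL (Fin N) ℂ) : Matrix (Fin N) (Fin N) ℂ)) +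
          fderiv ℝ f (((h : GL (Fin N) ℂ) : Matrix (Fin N) (Fin N) ℂ) * γ * (((h⁻¹ : archLocal L N (Matrix.diagonal a) w) : GL (Fin N) ℂ) : Matrix (Fin N) (Fin N) ℂ)) (((h : GL (Fin N) ℂ) : Matrix (Fin N) (Fin N) ℂ) * (P * γ + γ * P - (2 : ℂ) • (X * γ * X)) * (((h⁻¹ : archLocal L N (Matrix.diagonal a) w) : GL (Fin N) ℂ) : Matrix (Fin N) (Fin N) ℂ))) μ ∧
      ∫ h : archLocal L N (Matrix.diagonal a) w, (fderiv ℝ (fderiv ℝ f) (((h : GL (Fin N) ℂ) : Matrix (Fin N) (Fin N) ℂ) * γ * (((h⁻¹ : archLocal L N (Matrix.diagonal a) w) : GL (Fin N) ℂ) : Matrix (Fin N) (Fin N) ℂ)) (((h : GL (Fin N) ℂ) : Matrix (Fin N) (Fin N) ℂ) * (X * γ - γ * X) * (((h⁻¹ : archLocal L N (Matrix.diagonal a) w) : GL (Fin N) ℂ) : Matrix (Fin N) (Fin N) ℂ)) (((h : GL (Fin N) ℂ) : Matrix (Fin N) (Fin N) ℂ) * (X * γ - γ * X) * (((h⁻¹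 : archLocal L N (Matrix.diagonal a) w) : GL (Fin N) ℂ) : Matrix (Fin N) (Fin N) ℂ)) +
          fderiv ℝ f (((h : GL (Fin N) ℂ) : Matrix (Fin N) (Fin N) ℂ) * γ * (((h⁻¹ : archLocal L N (Matrix.diagonal a) w) : GL (Fin N) ℂ) : Matrix (Fin N) (Fin N) ℂ)) (((h : GL (Fin N) ℂ) : Matrix (Fin N) (Fin N) ℂ) * (P * γ + γ * P - (2 : ℂ) • (X * γ * X)) * (((h⁻¹ : archLocal L N (Matrix.diagonal a) w) : GL (Fin N) ℂ) : Matrix (Fin N) (Fin N) ℂ))) ∂μ = 0 := by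
  obtain ⟨U, hUc, hU⟩ := exists_blockBoost L a w X P hPP hPX hXP hXX hPs hPH hXH
  have hch : Continuous fun s : ℝ => cosh (s : ℂ) := Complex.continuous_cosh.comp Complex.continuous_ofReal
  have hsh : Continuous fun s : ℝ => sinh (s : ℂ) := Complex.continuous_sinh.comp Complex.continuous_ofReal
  have hup : Continuous fun s : ℝ => ((1 : Matrix (Fin N) (Fin N) ℂ) + (cosh (s : ℂ) - 1) • P + sinh (s : ℂ) • X) := (continuous_const.add ((hch.sub continuous_const).smul continuous_const)).add (hsh.smul continuous_const)
  have hum : Continuous fun s : ℝ => ((1 : Matrix (Fin N) (Fin N) ℂ) + (cosh (s : ℂ) - 1) • P - sinh (s : ℂ) • X) := (continuous_const.add ((hch.sub continuous_const).smul continuous_const)).sub (hsh.smul continuous_const)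
  have hup' : Continuous fun s : ℝ => (sinh (s : ℂ) • P + cosh (s : ℂ) • X) := (hsh.smul continuous_const).add (hch.smul continuous_const)
  have hum' : Continuous fun s : ℝ => (sinh (s : ℂ) • P - cosh (s : ℂ) • X) := (hsh.smul continuous_const).sub (hch.smul continuous_const)
  have hup'' : Continuous fun s : ℝ => (cosh (s : ℂ) • P + sinh (s : ℂ) • X) := (hch.smul continuous_const).add (hsh.smul continuous_const)
  have hum'' : Continuous fun s : ℝ => (cosh (s : ℂ) • P - sinh (s : ℂ) • X) := (hch.smul continuous_const).sub (hsh.smul continuous_const)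
  -- the conjugation curve and its jets (★ A2)
  obtain ⟨c, hc⟩ : ∃ c : ℝ → Matrix (Fin N) (Fin N) ℂ, c = fun s : ℝ => ((1 : Matrix (Fin N) (Fin N) ℂ) + (cosh (s : ℂ) - 1) • P + sinh (s : ℂ) • X) * γ * ((1 : Matrix (Fin N) (Fin N) ℂ) + (cosh (s : ℂ) - 1) • P - sinh (s : ℂ) • X) := ⟨_, rfl⟩
  obtain ⟨c₁, hc₁⟩ : ∃ c₁ : ℝ → Matrix (Fin N) (Fin N) ℂ, c₁ = fun s : ℝ =>
      (sinh (s : ℂ) • P + cosh (s : ℂ) • X) * γ * ((1 : Matrix (Fin N) (Fin N) ℂ) + (cosh (s : ℂ) - 1) • P - sinh (s : ℂ) • X) +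
        ((1 : Matrix (Fin N) (Fin N) ℂ) + (cosh (s : ℂ) - 1) • P + sinh (s : ℂ) • X) * γ * (sinh (s : ℂ) • P - cosh (s : ℂ) • X) := ⟨_, rfl⟩
  obtain ⟨c₂, hc₂⟩ : ∃ c₂ : ℝ → Matrix (Fin N) (Fin N) ℂ, c₂ = fun s : ℝ =>
      ((cosh (s : ℂ) • P + sinh (s : ℂ) • X) * γ * ((1 : Matrix (Fin N) (Fin N) ℂ) + (cosh (s : ℂ) - 1) • P - sinh (s : ℂ) • X) +
          (sinh (s : ℂ) • P + cosh (s : ℂ) • X) * γ * (sinh (s : ℂ) • P - cosh (s : ℂ) • X)) +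
        ((sinh (s : ℂ) • P + cosh (s : ℂ) • X) * γ * (sinh (s : ℂ) • P - cosh (s : ℂ) • X) +
          ((1 : Matrix (Fin N) (Fin N) ℂ) + (cosh (s : ℂ) - 1) • P + sinh (s : ℂ) • X) * γ * (cosh (s : ℂ) • P - sinh (s : ℂ) • X)) := ⟨_, rfl⟩
  have hcd : ∀ s, HasDerivAt c (c₁ s) s := fun s => by rw [hc, hc₁]; exact hasDerivAt_conjBlockBoost X P γ s
  have hc₁d : ∀ s, HasDerivAt c₁ (c₂ s) s := fun s => by rw [hc₁, hc₂]; exact hasDerivAt_conjBlockBoost_deriv X P γ s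
  have hc₂c : Continuous c₂ := by
    rw [hc₂]
    exact (((hup''.mul continuous_const).mul hum).add ((hup'.mul continuous_const).mul hum')).add
      (((hup'.mul continuous_const).mul hum').add ((hup.mul continuous_const).mul hum''))
  have e0 : c 0 = γ := by rw [hc]; exact conjBlockBoost_zero X P γ
  have e1 : c₁ 0 = X * γ - γ * X := by rw [hc₁]; exact conjBlockBoost_deriv_zero X P γ
  have e2 : c₂ 0 = (P * γ + γ * P - (2 : ℂ) • (X * γ * X)) := by rw [hc₂]; exact conjBlockBoost_deriv_deriv_zero X P γ
  have hconjU : ∀ (h : archLocal L N (Matrix.diagonal a) w) (s : ℝ),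
      (((h * U s : archLocal L N (Matrix.diagonal a) w) : GL (Fin N) ℂ) : Matrix (Fin N) (Fin N) ℂ) * γ * ((((h * U s)⁻¹ : archLocal L N (Matrix.diagonal a) w) : GL (Fin N) ℂ) : Matrix (Fin N) (Fin N) ℂ) =
        ((h : GL (Fin N) ℂ) : Matrix (Fin N) (Fin N) ℂ) * c s * (((h⁻¹ : archLocal L N (Matrix.diagonal a) w) : GL (Fin N) ℂ) : Matrix (Fin N) (Fin N) ℂ) := fun h s => by
    rw [_root_.mul_inv_rev, Subgroup.coe_mul, Subgroup.coe_mul, Units.val_mul, Units.val_mul, (hU s).1, (hU s).2, hc]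
    simp only [Matrix.mul_assoc]
  have hK₀ := isCompact_setOf_conj_diagonal_mem L a w ha hfc.isCompact hζ
  rw [← hγ] at hK₀
  have h := integral_curveJets_eq_zero (archLocal L N (Matrix.diagonal a) w) μ f hf hUc hcd hc₁d hc₂c e0 hconjU hK₀
  rw [e1, e2] at h
  exact h

/-- **Right-invariance kills the block-rotation jets at a regular torus point**: as `integral_blockBoostJet_eq_zero` with `X² = −P`, `u(s) = 1 + (cos s − 1)P + sin s·X`
and second jet `−(Pγ + γP) − 2XγX`. [cite: Varadarajan1989, §6.3] [cite: Folland1995, §2.6] -/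
theorem integral_blockRotJet_eq_zero (μ : Measure (archLocal L N (Matrix.diagonal a) w)) [IsFiniteMeasureOnCompacts μ] [μ.IsMulRightInvariant]
    (ha : ∀ i, a i ≠ 0) (f : Matrix (Fin N) (Fin N) ℂ → E) (hf : ContDiff ℝ 2 f) (hfc : HasCompactSupport f)
    (X P : Matrix (Fin N) (Fin N) ℂ) (hPP : P * P = P) (hPX : P * X = X) (hXP : X * P = X) (hXX : X * X = -P) (hPs : star P = P)
    (hPH : P * (Matrix.diagonal a).map w.1.embedding = (Matrix.diagonal a).map w.1.embedding * P) (hXH : star X * (Matrix.diagonal a).map w.1.embedding = -((Matrix.diagonal a).map w.1.embedding * X))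
    {ζ : Fin N → Circle} (hζ : Function.Injective ζ) {γ : Matrix (Fin N) (Fin N) ℂ} (hγ : γ = Matrix.diagonal fun i => (ζ i : ℂ)) :
    Integrable (fun h : archLocal L N (Matrix.diagonal a) w =>
        fderiv ℝ (fderiv ℝ f) (((h : GL (Fin N) ℂ) : Matrix (Fin N) (Fin N) ℂ) * γ * (((h⁻¹ : archLocal L N (Matrix.diagonal a) w) : GL (Fin N) ℂ) : Matrix (Fin N) (Fin N) ℂ)) (((h : GL (Fin N) ℂ) : Matrix (Fin N) (Fin N) ℂ) * (X * γ - γ * X) * (((h⁻¹ : archLocal L N (Matrix.diagonal a) w) : GL (Fin N) ℂ) : Matrix (Fin N) (Fin N) ℂ)) (((h : GL (Fin N) ℂ) : Matrix (Fin N) (Fin N) ℂ) * (X * γ - γ * X) * (((h⁻¹ : archLocal L N (Matrix.diagonal a) w) : GL (Fin N) ℂ) : Matrix (Fin N) (Fin N) ℂ)) +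
          fderiv ℝ f (((h : GL (Fin N) ℂ) : Matrix (Fin N) (Fin N) ℂ) * γ * (((h⁻¹ : archLocal L N (Matrix.diagonal a) w) : GL (Fin N) ℂ) : Matrix (Fin N) (Fin N) ℂ)) (((h : GL (Fin N) ℂ) : Matrix (Fin N) (Fin N) ℂ) * (-(P * γ + γ * P) - (2 : ℂ) • (X * γ * X)) * (((h⁻¹ : archLocal L N (Matrix.diagonal a) w) : GL (Fin N) ℂ) : Matrix (Fin N) (Fin N) ℂ))) μ ∧
      ∫ h : archLocal L N (Matrix.diagonal a) w, (fderiv ℝ (fderiv ℝ f) (((h : GL (Fin N) ℂ) : Matrix (Fin N) (Fin N) ℂ) * γ * (((h⁻¹ : archLocal L N (Matrix.diagonal a) w) : GL (Fin N) ℂ) : Matrix (Fin N) (Fin N) ℂ)) (((h : GL (Fin N) ℂ) : Matrix (Fin N) (Fin N) ℂ) * (X * γ - γ * X) * (((h⁻¹ : archLocal L N (Matrix.diagonal a) w) : GL (Fin N) ℂ) : Matrix (Fin N) (Fin N) ℂ)) (((h : GL (Fin N) ℂ) : Matrix (Fin N) (Fin N) ℂ) * (X * γ - γ * X) * (((h⁻¹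 : archLocal L N (Matrix.diagonal a) w) : GL (Fin N) ℂ) : Matrix (Fin N) (Fin N) ℂ)) +
          fderiv ℝ f (((h : GL (Fin N) ℂ) : Matrix (Fin N) (Fin N) ℂ) * γ * (((h⁻¹ : archLocal L N (Matrix.diagonal a) w) : GL (Fin N) ℂ) : Matrix (Fin N) (Fin N) ℂ)) (((h : GL (Fin N) ℂ) : Matrix (Fin N) (Fin N) ℂ) * (-(P * γ + γ * P) - (2 : ℂ) • (X * γ * X)) * (((h⁻¹ : archLocal L N (Matrix.diagonal a) w) : GL (Fin N) ℂ) : Matrix (Fin N) (Fin N) ℂ))) ∂μ = 0 := by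
  obtain ⟨U, hUc, hU⟩ := exists_blockRot L a w X P hPP hPX hXP hXX hPs hPH hXH
  have hch : Continuous fun s : ℝ => Complex.cos (s : ℂ) := Complex.continuous_cos.comp Complex.continuous_ofReal
  have hsh : Continuous fun s : ℝ => Complex.sin (s : ℂ) := Complex.continuous_sin.comp Complex.continuous_ofReal
  have hup : Continuous fun s : ℝ => ((1 : Matrix (Fin N) (Fin N) ℂ) + (Complex.cos (s : ℂ) - 1) • P + Complex.sin (s : ℂ) • X) := (continuous_const.add ((hch.sub continuous_const).smul continuous_const)).add (hsh.smul continuous_const)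
  have hum : Continuous fun s : ℝ => ((1 : Matrix (Fin N) (Fin N) ℂ) + (Complex.cos (s : ℂ) - 1) • P - Complex.sin (s : ℂ) • X) := (continuous_const.add ((hch.sub continuous_const).smul continuous_const)).sub (hsh.smul continuous_const)
  have hup' : Continuous fun s : ℝ => ((-(Complex.sin (s : ℂ))) • P + Complex.cos (s : ℂ) • X) := (hsh.neg.smul continuous_const).add (hch.smul continuous_const)
  have hum' : Continuous fun s : ℝ => ((-(Complex.sin (s : ℂ))) • P - Complex.cos (s : ℂ) • X) := (hsh.neg.smul continuous_const).sub (hch.smul continuous_const)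
  have hup'' : Continuous fun s : ℝ => ((-(Complex.cos (s : ℂ))) • P + (-(Complex.sin (s : ℂ))) • X) := (hch.neg.smul continuous_const).add (hsh.neg.smul continuous_const)
  have hum'' : Continuous fun s : ℝ => ((-(Complex.cos (s : ℂ))) • P - (-(Complex.sin (s : ℂ))) • X) := (hch.neg.smul continuous_const).sub (hsh.neg.smul continuous_const)
  -- the conjugation curve and its jets (★ A2)
  obtain ⟨c, hc⟩ : ∃ c : ℝ → Matrix (Fin N) (Fin N) ℂ, c = fun s : ℝ => ((1 : Matrix (Fin N) (Fin N) ℂ) + (Complex.cos (s : ℂ) - 1) • P + Complex.sin (s : ℂ) • X) * γ * ((1 : Matrix (Fin N) (Fin N) ℂ) + (Complex.cos (s : ℂ) - 1) • P - Complex.sin (s : ℂ) • X) := ⟨_, rfl⟩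
  obtain ⟨c₁, hc₁⟩ : ∃ c₁ : ℝ → Matrix (Fin N) (Fin N) ℂ, c₁ = fun s : ℝ =>
      ((-(Complex.sin (s : ℂ))) • P + Complex.cos (s : ℂ) • X) * γ * ((1 : Matrix (Fin N) (Fin N) ℂ) + (Complex.cos (s : ℂ) - 1) • P - Complex.sin (s : ℂ) • X) +
        ((1 : Matrix (Fin N) (Fin N) ℂ) + (Complex.cos (s : ℂ) - 1) • P + Complex.sin (s : ℂ) • X) * γ * ((-(Complex.sin (s : ℂ))) • P - Complex.cos (s : ℂ) • X) := ⟨_, rfl⟩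
  obtain ⟨c₂, hc₂⟩ : ∃ c₂ : ℝ → Matrix (Fin N) (Fin N) ℂ, c₂ = fun s : ℝ =>
      (((-(Complex.cos (s : ℂ))) • P + (-(Complex.sin (s : ℂ))) • X) * γ * ((1 : Matrix (Fin N) (Fin N) ℂ) + (Complex.cos (s : ℂ) - 1) • P - Complex.sin (s : ℂ) • X) +
          ((-(Complex.sin (s : ℂ))) • P + Complex.cos (s : ℂ) • X) * γ * ((-(Complex.sin (s : ℂ))) • P - Complex.cos (s : ℂ) • X)) +
        (((-(Complex.sin (s : ℂ))) • P + Complex.cos (s : ℂ) • X) * γ * ((-(Complex.sin (s : ℂ))) • P - Complex.cos (s : ℂ) • X) +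
          ((1 : Matrix (Fin N) (Fin N) ℂ) + (Complex.cos (s : ℂ) - 1) • P + Complex.sin (s : ℂ) • X) * γ * ((-(Complex.cos (s : ℂ))) • P - (-(Complex.sin (s : ℂ))) • X)) := ⟨_, rfl⟩
  have hcd : ∀ s, HasDerivAt c (c₁ s) s := fun s => by rw [hc, hc₁]; exact hasDerivAt_conjBlockRot X P γ s
  have hc₁d : ∀ s, HasDerivAt c₁ (c₂ s) s := fun s => by rw [hc₁, hc₂]; exact hasDerivAt_conjBlockRot_deriv X P γ s
  have hc₂c : Continuous c₂ := by
    rw [hc₂]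
    exact (((hup''.mul continuous_const).mul hum).add ((hup'.mul continuous_const).mul hum')).add
      (((hup'.mul continuous_const).mul hum').add ((hup.mul continuous_const).mul hum''))
  have e0 : c 0 = γ := by rw [hc]; exact conjBlockRot_zero X P γ
  have e1 : c₁ 0 = X * γ - γ * X := by rw [hc₁]; exact conjBlockRot_deriv_zero X P γ
  have e2 : c₂ 0 = (-(P * γ + γ * P) - (2 : ℂ) • (X * γ * X)) := by rw [hc₂]; exact conjBlockRot_deriv_deriv_zero X P γ
  have hconjU : ∀ (h : archLocal L N (Matrix.diagonal a) w) (s : ℝ),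
      (((h * U s : archLocal L N (Matrix.diagonal a) w) : GL (Fin N) ℂ) : Matrix (Fin N) (Fin N) ℂ) * γ * ((((h * U s)⁻¹ : archLocal L N (Matrix.diagonal a) w) : GL (Fin N) ℂ) : Matrix (Fin N) (Fin N) ℂ) =
        ((h : GL (Fin N) ℂ) : Matrix (Fin N) (Fin N) ℂ) * c s * (((h⁻¹ : archLocal L N (Matrix.diagonal a) w) : GL (Fin N) ℂ) : Matrix (Fin N) (Fin N) ℂ) := fun h s => by
    rw [_root_.mul_inv_rev, Subgroup.coe_mul, Subgroup.coe_mul, Units.val_mul, Units.val_mul, (hU s).1, (hU s).2, hc]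
    simp only [Matrix.mul_assoc]
  have hK₀ := isCompact_setOf_conj_diagonal_mem L a w ha hfc.isCompact hζ
  rw [← hγ] at hK₀
  have h := integral_curveJets_eq_zero (archLocal L N (Matrix.diagonal a) w) μ f hf hUc hcd hc₁d hc₂c e0 hconjU hK₀
  rw [e1, e2] at h
  exact h

end Jets

end Literature.NumberTheory.Automorphic.RootVectors
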